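import Literature.Claims.NS.Nadirashvili2026
import Literature.Analysis.FluidPDE.TsaiMaximumPrinciple
import Mathlib.Topology.Order.Compact
import Mathlib.Topology.Order.ProjIcc
import HarnessLib

/-!
# Solo salvage for claim C129 `Nadirashvili2026` (cell `ns-claims`, D-0090): the sup-argument
# (5.19)–(5.23), pp. 36–37, is TRUE — a first-contact lemma, kernel

Claim skeleton: `Literature/Claims/NS/Nadirashvili2026.lean` (N. Nadirashvili, arXiv:2606.02811 v4; typist
`ns-claims-typist-7` g3). VERDICT (refuter-5 g2 04:50:04Z): first failing step `Step_subsol` (5.18) p. 36,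
false lemma (`…Theorems.Nadirashvili2026.not_Step_subsol` p496929); (5.13) p. 35 `Step_SN1_abs` false
alongside (p497005). This file (seat `ns-claims-salvage-p3` g3) certifies that Step 11 `Step_sup` — the
comparison / first-contact argument of the endgame, with the four typos read as intended — holds as a
statement of real analysis: for `Φ(r,t) = y(r) − E(r,t)` on `[0,δ] × [t₂,t₃]` with `Φ(0,·) = 0`,
`∂ᵣΦ(δ,·) < 0`, `sup Φ(·,t₂) > 0` and `Φ(·,t₃) < 0` inside, there are `T ∈ (t₂,t₃)` and an interior
`r₀` with `E_r(r₀,T) = y′(r₀)`, `E_rr(r₀,T) ≥ y″(r₀)`, `E_t(r₀,T) ≥ 0` (take `c = ½ sup Φ(·,t₂)`,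
`T = sup{t : max Φ(·,t) ≥ c}`, `r₀` a maximiser of `Φ(·,T)`). Mathematics: the elementary maximum
principle / first touching point; nothing of the paper beyond the bookkeeping (5.19)–(5.23).

* `nadirashvili2026_step_sup_holds : Literature.Claims.NS.Nadirashvili2026.Step_sup`.

Solo lane (`Theorems/SoloSalvage<Slug>….lean`, no item).

WHAT THIS IS NOT: not a claim about NS regularity or blow-up; not a claim about any author beyond the
typed locator.
-/

noncomputable section

set_option linter.dupNamespace false

open Set Filter Topology

namespace Summit.NavierStokesRegularity.NavierStokesRegularity.Theorems.Nadirashvili2026Salvage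

open Literature.Analysis.FluidPDE

/-- A function with negative derivative at `b` takes, just to the left of `b`, values larger than
`f b`. [folklore] -/
theorem exists_lt_of_hasDerivAt_neg {f : ℝ → ℝ} {f' b a : ℝ} (hf : HasDerivAt f f' b) (hf' : f' < 0)
    (hab : a < b) : ∃ x ∈ Ioo a b, f b < f x := by
  have ht : Tendsto (slope f b) (𝓝[<] b) (𝓝 f') :=
    (hasDerivAt_iff_tendsto_slope.1 hf).mono_left (nhdsWithin_mono _ fun x hx => ne_of_lt hx)
  have hev : ∀ᶠ x in 𝓝[<] b, slope f b x < 0 := ht (Iio_mem_nhds hf')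
  have hev2 : ∀ᶠ x in 𝓝[<] b, x ∈ Ioo a b := Ioo_mem_nhdsLT hab
  obtain ⟨x, hx1, hx2⟩ := (hev.and hev2).exists
  refine ⟨x, hx2, ?_⟩
  have hxb : x - b < 0 := by linarith [hx2.2]
  rw [slope_def_field] at hx1
  have := (div_neg_iff.1 hx1)
  rcases this with ⟨h1, -⟩ | ⟨-, h2⟩
  · linarith
  · linarith

/-- A function differentiable at `T` which does not go below `f T` just to the right of `T` has
non-negative derivative at `T`. [folklore] -/
theorem deriv_nonneg_of_forall_gt {f : ℝ → ℝ} {T t₃ : ℝ} (hf : DifferentiableAt ℝ f T) (hT : T < t₃)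
    (h : ∀ t ∈ Ioc T t₃, f T ≤ f t) : 0 ≤ deriv f T := by
  have ht : Tendsto (slope f T) (𝓝[>] T) (𝓝 (deriv f T)) :=
    (hasDerivAt_iff_tendsto_slope.1 hf.hasDerivAt).mono_left
      (nhdsWithin_mono _ fun x hx => ne_of_gt hx)
  refine ge_of_tendsto ht ?_
  filter_upwards [Ioc_mem_nhdsGT hT] with t ht'
  rw [slope_def_field]
  exact div_nonneg (by linarith [h t ht']) (by linarith [ht'.1])

/-- **Step 11 of C129 is TRUE** — pp. 36–37 [1607–1645], (5.19)–(5.23): the sup-argument yields an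
interior first-contact point `(r₀, T)` with `E_r = y′`, `E_rr ≥ y″`, `E_t ≥ 0`
(`Step_sup`, typed as a statement of real analysis with the four typos read as intended).
[cite: Nadirashvili2026, (5.19)–(5.23) pp. 36–37] -/
theorem nadirashvili2026_step_sup_holds : Literature.Claims.NS.Nadirashvili2026.Step_sup := by
  intro δ t₂ t₃ y y' y'' E hδ ht hy0 hy hy' hEc hEO hE0 hslope hlt₂ hgt₃
  obtain ⟨O, hOopen, hOsub, hEC2⟩ := hEO
  -- ### the comparison function and its continuous extension
  have hyc : ContinuousOn y (Icc 0 δ) := fun x hx => (hy x hx).continuousAt.continuousWithinAt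
  set Φ : ℝ → ℝ → ℝ := fun r t => y r - E r t with hΦ
  have hΦc : ContinuousOn (fun z : ℝ × ℝ => Φ z.1 z.2) (Icc 0 δ ×ˢ Icc t₂ t₃) :=
    (hyc.comp continuousOn_fst fun z hz => hz.1).sub hEc
  set Ψ : ℝ → ℝ → ℝ := fun t r => Φ (projIcc 0 δ hδ.le r) (projIcc t₂ t₃ ht.le t) with hΨ
  have hΨc : Continuous (Function.uncurry Ψ) := by
    have h1 : Continuous fun z : ℝ × ℝ =>
        ((projIcc 0 δ hδ.le z.2 : ℝ), (projIcc t₂ t₃ ht.le z.1 : ℝ)) :=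
      (continuous_subtype_val.comp (continuous_projIcc.comp continuous_snd)).prodMk
        (continuous_subtype_val.comp (continuous_projIcc.comp continuous_fst))
    refine (hΦc.comp_continuous h1 fun z => ⟨(projIcc 0 δ hδ.le z.2).2, (projIcc t₂ t₃ ht.le z.1).2⟩)
  have hΨeq : ∀ t ∈ Icc t₂ t₃, ∀ r ∈ Icc 0 δ, Ψ t r = Φ r t := by
    intro t ht' r hr
    simp only [hΨ, projIcc_of_mem hδ.le hr, projIcc_of_mem ht.le ht']
  -- the sup over `r`
  set φ : ℝ → ℝ := fun t => sSup (Ψ t '' Icc 0 δ) with hφ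
  have hK : IsCompact (Icc (0 : ℝ) δ) := isCompact_Icc
  have hKne : (Icc (0 : ℝ) δ).Nonempty := nonempty_Icc.2 hδ.le
  have hφc : Continuous φ := hK.continuous_sSup hΨc
  have hΨtc : ∀ t, Continuous (Ψ t) := fun t => hΨc.comp (Continuous.prodMk_right t)
  have hmax : ∀ t, ∃ r ∈ Icc 0 δ, φ t = Ψ t r ∧ ∀ r' ∈ Icc 0 δ, Ψ t r' ≤ Ψ t r := fun t =>
    hK.exists_sSup_image_eq_and_ge hKne (hΨtc t).continuousOn
  have hle : ∀ t, ∀ r ∈ Icc 0 δ, Ψ t r ≤ φ t := by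
    intro t r hr
    obtain ⟨r₁, -, h1, h2⟩ := hmax t
    rw [h1]; exact h2 r hr
  -- ### the level `c` and the values of `φ` at `t₂`, `t₃`
  obtain ⟨x₁, hx₁, hx₁lt⟩ := hlt₂
  set c : ℝ := (y x₁ - E x₁ t₂) / 2 with hc
  have hc0 : 0 < c := by rw [hc]; linarith
  have ht₂mem : t₂ ∈ Icc t₂ t₃ := ⟨le_rfl, ht.le⟩
  have ht₃mem : t₃ ∈ Icc t₂ t₃ := ⟨ht.le, le_rfl⟩
  have hφ₂ : 2 * c ≤ φ t₂ := by
    have h := hle t₂ x₁ (Ioo_subset_Icc_self hx₁)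
    rw [hΨeq t₂ ht₂mem x₁ (Ioo_subset_Icc_self hx₁)] at h
    have : 2 * c = Φ x₁ t₂ := by rw [hc, hΦ]; ring
    linarith
  have hφ₃ : φ t₃ ≤ 0 := by
    obtain ⟨r₁, hr₁, h1, -⟩ := hmax t₃
    rw [h1]
    -- `Ψ t₃ < 0` on `(0,δ)`, `= 0` at `0`, hence `≤ 0` on the closure
    have hneg : ∀ r ∈ Ioo 0 δ, Ψ t₃ r < 0 := by
      intro r hr
      rw [hΨeq t₃ ht₃mem r (Ioo_subset_Icc_self hr)]
      show y r - E r t₃ < 0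
      linarith [hgt₃ r hr]
    have hcl : closure (Ioo (0 : ℝ) δ) ⊆ {r | Ψ t₃ r ≤ 0} := by
      have h := closure_lt_subset_le (hΨtc t₃) continuous_const (f := Ψ t₃) (g := fun _ => (0 : ℝ))
      refine (closure_mono fun r hr => ?_).trans h
      exact hneg r hr
    rw [closure_Ioo hδ.ne] at hcl
    exact hcl hr₁
  -- ### the first-contact time `T`
  set A : Set ℝ := {t | t ∈ Icc t₂ t₃ ∧ c ≤ φ t} with hA
  have hAcl : IsClosed A := isClosed_Icc.inter (isClosed_le continuous_const hφc)
  have ht₂A : t₂ ∈ A := ⟨ht₂mem, by linarith⟩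
  have hAbdd : BddAbove A := ⟨t₃, fun t ht' => ht'.1.2⟩
  set T : ℝ := sSup A with hT
  have hTA : T ∈ A := hAcl.csSup_mem ⟨t₂, ht₂A⟩ hAbdd
  have hT₂ : t₂ ≤ T := le_csSup hAbdd ht₂A
  have hTmem : T ∈ Icc t₂ t₃ := hTA.1
  have hT₃ : T < t₃ := by
    rcases eq_or_lt_of_le hTmem.2 with h | h
    · exfalso
      have : c ≤ φ t₃ := by rw [← h]; exact hTA.2
      linarith
    · exact h
  have hafter : ∀ t ∈ Ioc T t₃, φ t < c := by
    intro t ht'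
    by_contra h
    push Not at h
    have htA : t ∈ A := ⟨⟨hT₂.trans ht'.1.le, ht'.2⟩, h⟩
    exact (lt_irrefl _) (ht'.1.trans_le (le_csSup hAbdd htA))
  have hφT : φ T = c := by
    refine le_antisymm ?_ hTA.2
    by_contra h
    push Not at h
    -- continuity: `φ > c` a bit to the right of `T`
    have hev : ∀ᶠ t in 𝓝 T, c < φ t := hφc.continuousAt.eventually (lt_mem_nhds h)
    obtain ⟨ε, hε, hball⟩ := Metric.eventually_nhds_iff.1 hev
    set t : ℝ := min (T + ε / 2) ((T + t₃) / 2) with htdef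
    have htT : T < t := lt_min (by linarith) (by linarith)
    have ht3 : t ≤ t₃ := (min_le_right _ _).trans (by linarith)
    have hdist : dist t T < ε := by
      rw [Real.dist_eq, abs_of_pos (by linarith)]
      linarith [min_le_left (T + ε / 2) ((T + t₃) / 2)]
    exact (lt_irrefl _) ((hball hdist).trans (hafter t ⟨htT, ht3⟩))
  have hTgt : t₂ < T := by
    rcases eq_or_lt_of_le hT₂ with h | h
    · exfalso; rw [← h] at hφT; linarith
    · exact h
  -- ### the contact point `r₀`
  obtain ⟨r₀, hr₀, hφr₀, hmaxr₀⟩ := hmax T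
  have hΦr₀ : Φ r₀ T = c := by rw [← hΨeq T hTmem r₀ hr₀, ← hφr₀, hφT]
  set g : ℝ → ℝ := fun r => Φ r T with hg
  have hgmax : IsMaxOn g (Icc 0 δ) r₀ := by
    intro r hr
    show Φ r T ≤ Φ r₀ T
    rw [← hΨeq T hTmem r hr, ← hΨeq T hTmem r₀ hr₀]
    exact hmaxr₀ r hr
  -- slices of `E` are `C²` near `(0,δ] × {T}`
  set U : Set ℝ := {r | (r, T) ∈ O} with hU
  have hUopen : IsOpen U := hOopen.preimage (continuous_id.prodMk continuous_const)
  have hUsub : Ioc 0 δ ⊆ U := fun r hr => hOsub ⟨hr, hTmem⟩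
  have hsC2 : ContDiffOn ℝ 2 (fun r => E r T) U :=
    hEC2.comp (contDiff_id.prodMk contDiff_const).contDiffOn fun r hr => hr
  have hsd : ∀ r ∈ U, DifferentiableAt ℝ (fun r => E r T) r := fun r hr =>
    (hsC2.differentiableOn (by norm_num) r hr).differentiableAt (hUopen.mem_nhds hr)
  have hds : ContDiffOn ℝ 1 (deriv fun r => E r T) U := hsC2.deriv_of_isOpen hUopen (by norm_num)
  have hdsd : ∀ r ∈ U, DifferentiableAt ℝ (deriv fun r => E r T) r := fun r hr =>
    (hds.differentiableOn one_ne_zero r hr).differentiableAt (hUopen.mem_nhds hr)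
  -- derivative of `g` at points of `(0, δ]`
  have hgd : ∀ r ∈ Ioc 0 δ, HasDerivAt g (y' r - deriv (fun r => E r T) r) r := fun r hr =>
    (hy r ⟨hr.1.le, hr.2⟩).sub (hsd r (hUsub hr)).hasDerivAt
  -- `r₀ ≠ 0`
  have hr₀0 : r₀ ≠ 0 := by
    intro h
    have : Φ 0 T = 0 := by show y 0 - E 0 T = 0; rw [hy0, hE0 T hTmem, sub_zero]
    rw [h] at hΦr₀
    linarith
  -- `r₀ ≠ δ`: the derivative of `g` at `δ` is negative
  have hr₀δ : r₀ ≠ δ := by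
    intro h
    have hneg : y' δ - deriv (fun r => E r T) δ < 0 := by linarith [hslope T hTmem]
    obtain ⟨x, hx, hlt⟩ := exists_lt_of_hasDerivAt_neg (hgd δ ⟨hδ, le_rfl⟩) hneg hδ
    have := hgmax (Ioo_subset_Icc_self hx)
    rw [h] at this
    exact (lt_irrefl _) (hlt.trans_le this)
  have hr₀' : r₀ ∈ Ioo 0 δ := ⟨lt_of_le_of_ne hr₀.1 (Ne.symm hr₀0), lt_of_le_of_ne hr₀.2 hr₀δ⟩
  have hr₀U : r₀ ∈ U := hUsub ⟨hr₀'.1, hr₀'.2.le⟩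
  -- local maximum ⇒ first and second order conditions
  have hloc : IsLocalMax g r₀ := hgmax.isLocalMax (Icc_mem_nhds hr₀'.1 hr₀'.2)
  have hg1 : deriv g r₀ = y' r₀ - deriv (fun r => E r T) r₀ := (hgd r₀ ⟨hr₀'.1, hr₀'.2.le⟩).deriv
  have hfirst : deriv (fun r => E r T) r₀ = y' r₀ := by
    have := hloc.deriv_eq_zero
    rw [hg1] at this
    linarith
  -- `deriv g = y' − deriv (E · T)` near `r₀`, hence `deriv (deriv g) r₀ = y'' r₀ − E_rr`
  have hnhds : ∀ᶠ r in 𝓝 r₀, deriv g r = y' r - deriv (fun r => E r T) r := by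
    filter_upwards [Ioo_mem_nhds hr₀'.1 hr₀'.2] with r hr using (hgd r ⟨hr.1, hr.2.le⟩).deriv
  have hg2 : deriv (deriv g) r₀ = y'' r₀ - iteratedDeriv 2 (fun r => E r T) r₀ := by
    rw [Filter.EventuallyEq.deriv_eq hnhds, iteratedDeriv_succ, iteratedDeriv_one]
    exact ((hy' r₀ hr₀).sub (hdsd r₀ hr₀U).hasDerivAt).deriv
  have hsecond : y'' r₀ ≤ iteratedDeriv 2 (fun r => E r T) r₀ := by
    have h := deriv_deriv_nonpos_of_isLocalMax hloc (hgd r₀ ⟨hr₀'.1, hr₀'.2.le⟩).continuousAt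
    rw [hg2] at h
    linarith
  -- ### the time derivative at `(r₀, T)`
  have htd : DifferentiableAt ℝ (fun t => E r₀ t) T := by
    have h1 : ContDiffAt ℝ 2 (Function.uncurry E) (r₀, T) := hEC2.contDiffAt (hOopen.mem_nhds hr₀U)
    have h2 : DifferentiableAt ℝ (Function.uncurry E) (r₀, T) := h1.differentiableAt (by norm_num)
    exact h2.comp T (differentiableAt_const _ |>.prodMk differentiableAt_id)
  have hthird : 0 ≤ deriv (fun t => E r₀ t) T := by
    refine deriv_nonneg_of_forall_gt htd hT₃ fun t ht' => ?_
    have h1 := hle t r₀ hr₀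
    rw [hΨeq t ⟨hT₂.trans ht'.1.le, ht'.2⟩ r₀ hr₀] at h1
    have h2 := hafter t ht'
    have h3 : Φ r₀ t < Φ r₀ T := by linarith
    show E r₀ T ≤ E r₀ t
    have : y r₀ - E r₀ t < y r₀ - E r₀ T := h3
    linarith
  exact ⟨T, ⟨hTgt, hT₃⟩, r₀, hr₀', hfirst, hsecond, hthird⟩

end Summit.NavierStokesRegularity.NavierStokesRegularity.Theorems.Nadirashvili2026Salvage

end
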